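import Mathlib
import Literature.Computability.Complexity.CookLevinSAT
import Literature.Computability.Complexity.TableauSnapshotsProofs
import Literature.Computability.Complexity.ParsimoniousCookLevin
import Literature.Computability.FineGrained.SerfSNPInSNPProofs
import HarnessLib

/-!
# Cook–Levin with the Levin witness map in `FP` (stub `stub_levin` of line `SketchIdeator5`)

For a polynomial-time relation `R` (pairs `boolPair x u`) and a certificate bound `p`: a CNF family
`Φ x`, its code generator `gen ∈ FP` and a WITNESS MAP `wit ∈ FP` — `Φ x` is satisfiable iff some `u`,
`|u| ≤ p |x|`, has `⟨x, u⟩ ∈ R`, and from any such `u` the map `wit` computes the bit list of a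
satisfying assignment of `Φ x` (Arora–Barak 2009, Lemma 2.11 with §2.3.6 "Levin reductions").

* `Φ x` is the tree's Cook–Levin CNF `CookLevin.cnfN M p q x` (tableau CNF of a `FinTM2` decider `M`
  of `R`, variables `uname (b · MM + idx v)`, `CookLevinSAT.lean`) with its variables COMPRESSED to
  their occurrence ranks (`SerfRename.compress`, `SerfSNPProofs.lean`): the names `uname m = 2ᵐ - 1`
  are exponentially sparse, the ranks are `< |code|`, so that a bit LIST can carry the assignment;
  `gen = SerfRename.coreF ∘ reduceSAT M p q` (`coreF_encode`, `reduceSAT_mem_FP`).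
* `wit` (`Levin.witFn`) is a brick assembly (`FoldBricks.lean`, `PlumbingBricks.lean`): for every
  position `r < |code|` an inner counted fold computes, in unary, `m_r = #{m : rank (uname (m+1)) ≤ r}`
  (`SerfRename.rankF`), which for `r = rank (uname m₀)` of an occurring variable is `m₀ = b · MM + i`
  (`Levin.cntU_eq`); two unary divisions (`Plumb.divModFn`) give the block `b = t · RB + J` and the
  value index `i`, one query of the snapshot function `Tableau.snapFn M` (`TableauSnapshotsProofs.lean`)
  reads block `J` of configuration `t` of the run of `M` on `⟨x, u⟩`, and the emitted bit is
  `[its value index = i]` — the intended assignment `Tableau.intended` of `CookLevinTableau.lean`,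
  which satisfies the tableau (`Tableau.complete`).
-/

set_option linter.dupNamespace false -- summit = sub-problem (D-0017)

noncomputable section

namespace Summit.PneNP.PneNP.Theorems.LatticeMagicTarget

open Literature.Computability.Complexity _root_.Computability
open Literature.Computability.FineGrained Literature.Computability.FineGrained.SerfRename
open CookLevin Tableau Brick Plumb Polynomial Turing

namespace Levin

variable (M : TM2ComputableAux Bool Bool) (p q : Polynomial ℕ)

/-! ### The bricks of the witness map -/

/-- The row width `RB = (2n + 2 + p n) + d · q (2n + 2 + p n) + 3d + 1` as a polynomial in `n`. [folklore] -/
def rbPoly : Polynomial ℕ :=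
  (C 2 * X + C 2 + p) + C (dM M) * q.comp (C 2 * X + C 2 + p) + C (3 * dM M + 1)

/-- `rbPoly` evaluates to the row width `RB`. [folklore] -/
theorem rbPoly_eval (n : ℕ) : (rbPoly M p q).eval n = RB M n (CookLevin.PP p n) (TT p q n) := by
  simp [rbPoly, RB, S1, NN, CookLevin.PP, TT, eval_comp]; ring

/-- On the inner argument `s = ⟨⟨⟨z, code⟩, 1ʳ⟩, 1ᵐ⟩`: the test bit `[rank (uname (m+1)) < r + 1]`
(`SerfRename.rankF` on `⟨code, 1^{m+1}⟩`, compared by `ltFn` with the numeral of `r + 1`). [folklore] -/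
def levinTest : List Bool → List Bool :=
  ltFn ∘ fanoutFn (rankF ∘ fanoutFn (sndF ∘ fstF ∘ fstF) (List.cons true ∘ sndF))
    (lenBinF ∘ List.cons true ∘ sndF ∘ fstF)

/-- The inner piece: `1` if the test bit is set, `ε` otherwise. [folklore] -/
def pieceM : List Bool → List Bool := iteFn levinTest (fun _ => [true]) (fun _ => [])

/-- The initial record `⟨w, ⟨⌜|cd w|⌝, ⟨1⁰, ε⟩⟩⟩` of a counted fold over the positions of `cd w`. [folklore] -/
def levinInit (cd : List Bool → List Bool) : List Bool → List Bool :=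
  fanoutFn (fun w => w) (fanoutFn (lenBinF ∘ cd) (fun _ => boolPair (ones 0) []))

/-- On the outer argument `q = ⟨⟨z, code⟩, 1ʳ⟩`: the unary count `1^{#{m < |code| : test}}`. [folklore] -/
def cntU : List Bool → List Bool := sndPow 2 ∘ foldLoop appF pieceM X ∘ levinInit (sndF ∘ fstF)

/-- On `q`: `⟨1ᵇ, 1ⁱ⟩`, the count divided by the number `MM` of block values. [folklore] -/
def dm1 : List Bool → List Bool := divModFn ∘ fanoutFn (fun _ => ones (MMv M)) cntU

/-- On `q`: `⟨1ᵗ, 1ᴶ⟩`, the block `b` divided by the row width `RB` (`polyFn rbPoly` on `x`). [folklore] -/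
def dm2 : List Bool → List Bool :=
  divModFn ∘ fanoutFn (polyFn (rbPoly M p q) ∘ fstF ∘ fstF ∘ fstF) (fstF ∘ dm1 M)

/-- On `q`: the snapshot query `⟨z, ⟨1ᵗ, ⟨1ᴶ, ε⟩⟩⟩`. [folklore] -/
def queryF : List Bool → List Bool :=
  fanoutFn (fstF ∘ fstF) (fanoutFn (fstF ∘ dm2 M p q) (fanoutFn (sndF ∘ dm2 M p q) (fun _ => [])))

/-- On `q`: the outer piece, the bit `[value index of block J of configuration t = i]`. [folklore] -/
def pieceR : List Bool → List Bool := eqValFn ∘ fanoutFn (snapFn M ∘ queryF M p q) (sndF ∘ dm1 M)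

/-- The context `⟨z, code⟩` of the input `z = ⟨x, u⟩`: the code of `φₓ` by `reduceSAT`. [folklore] -/
def ctxF : List Bool → List Bool := fanoutFn (fun z => z) (reduceSAT M p q ∘ fstF)

/-- **The Levin witness map**: the concatenation fold of the outer pieces over the positions of the
code of `φₓ`. [cite: AroraBarakCC2009, Lemma 2.11 and §2.3.6] -/
def witFn : List Bool → List Bool :=
  sndPow 2 ∘ foldLoop appF (pieceR M p q) X ∘ levinInit sndF ∘ ctxF M p q

/-! ### Polynomial time -/

/-- `levinTest ∈ FP`. [cite: AroraBarakCC2009, §1.3] -/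
theorem levinTest_mem_FP : levinTest ∈ FP :=
  comp_mem_FP ltFn_mem_FP (fanoutFn_mem_FP
    (comp_mem_FP rankF_mem_FP (fanoutFn_mem_FP
      (comp_mem_FP sndF_mem_FP (comp_mem_FP fstF_mem_FP fstF_mem_FP))
      (comp_mem_FP (cons_mem_FP true) sndF_mem_FP)))
    (comp_mem_FP lenBinF_mem_FP (comp_mem_FP (cons_mem_FP true) (comp_mem_FP sndF_mem_FP fstF_mem_FP))))

/-- The inner piece is `1` or `ε` on every argument. [folklore] -/
theorem pieceM_eq (w : List Bool) : pieceM w = if levinTest w = [true] then [true] else [] := by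
  obtain ⟨b, hb⟩ : ∃ b, levinTest w = [b] := (oneBit_ltFn.comp _ : OneBit levinTest) w
  rw [pieceM, iteFn_apply hb, hb]
  cases b <;> simp

/-- Growth of the inner piece: at most one symbol. [folklore] -/
theorem length_pieceM_le (w : List Bool) : (pieceM w).length ≤ 1 * ((fstF w).length + 1) := by
  rw [pieceM_eq]; split_ifs <;> simp

/-- `pieceM ∈ FP`. [cite: AroraBarakCC2009, §1.3] -/
theorem pieceM_mem_FP : pieceM ∈ FP := iteFn_mem_FP levinTest_mem_FP (const_mem_FP _) (const_mem_FP _)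

/-- `levinInit cd ∈ FP` for `cd ∈ FP`. [cite: AroraBarakCC2009, §1.3] -/
theorem levinInit_mem_FP {cd : List Bool → List Bool} (h : cd ∈ FP) : levinInit cd ∈ FP :=
  fanoutFn_mem_FP (PolyTimeComputable.id _) (fanoutFn_mem_FP (comp_mem_FP lenBinF_mem_FP h) (const_mem_FP _))

/-- `cntU ∈ FP` (a counted fold of one-symbol pieces). [cite: AroraBarakCC2009, §1.3] -/
theorem cntU_mem_FP : cntU ∈ FP :=
  comp_mem_FP (sndPow_mem_FP 2) (comp_mem_FP
    (foldLoop_mem_FP (C := 1) appF_mem_FP length_appF_le pieceM_mem_FP length_pieceM_le _)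
    (levinInit_mem_FP (comp_mem_FP sndF_mem_FP fstF_mem_FP)))

/-- `dm1 ∈ FP`. [cite: AroraBarakCC2009, §1.3] -/
theorem dm1_mem_FP : dm1 M ∈ FP :=
  comp_mem_FP divModFn_mem_FP (fanoutFn_mem_FP (const_mem_FP _) cntU_mem_FP)

/-- `dm2 ∈ FP`. [cite: AroraBarakCC2009, §1.3] -/
theorem dm2_mem_FP : dm2 M p q ∈ FP :=
  comp_mem_FP divModFn_mem_FP (fanoutFn_mem_FP
    (comp_mem_FP (polyFn_mem_FP _) (comp_mem_FP fstF_mem_FP (comp_mem_FP fstF_mem_FP fstF_mem_FP)))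
    (comp_mem_FP fstF_mem_FP (dm1_mem_FP M)))

/-- The outer piece is a one-bit condition. [folklore] -/
theorem oneBit_pieceR : OneBit (pieceR M p q) := oneBit_eqValFn.comp _

/-- `pieceR ∈ FP` (the snapshot function `snapFn M ∈ FP`). [cite: AroraBarakCC2009, Thm. 1.9 and §1.4.1] -/
theorem pieceR_mem_FP : pieceR M p q ∈ FP :=
  comp_mem_FP eqValFn_mem_FP (fanoutFn_mem_FP (comp_mem_FP (snapFn_mem_FP M)
    (fanoutFn_mem_FP (comp_mem_FP fstF_mem_FP fstF_mem_FP) (fanoutFn_mem_FP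
      (comp_mem_FP fstF_mem_FP (dm2_mem_FP M p q))
      (fanoutFn_mem_FP (comp_mem_FP sndF_mem_FP (dm2_mem_FP M p q)) (const_mem_FP _)))))
    (comp_mem_FP sndF_mem_FP (dm1_mem_FP M)))

/-- **The witness map is polynomial time** (`reduceSAT_mem_FP` supplies the context). [cite: AroraBarakCC2009, Lemma 2.11] -/
theorem witFn_mem_FP : witFn M p q ∈ FP :=
  comp_mem_FP (sndPow_mem_FP 2) (comp_mem_FP
    (foldLoop_mem_FP (C := 1) appF_mem_FP length_appF_le (pieceR_mem_FP M p q)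
      (fun w => by rw [(oneBit_pieceR M p q).length_eq]; omega) _)
    (comp_mem_FP (levinInit_mem_FP sndF_mem_FP)
      (fanoutFn_mem_FP (PolyTimeComputable.id _) (comp_mem_FP (reduceSAT_mem_FP M p q) fstF_mem_FP))))

/-! ### Values -/

/-- A concatenation of one-symbol pieces, read positionwise. [folklore] -/
theorem ccat_getD {g : ℕ → List Bool} (hg : ∀ j, ∃ b, g j = [b]) {K r : ℕ} (hr : r < K) :
    (ccat g K).getD r false = (g r).headD false := by
  have key : ∀ K, ccat g K = (List.range K).map fun j => (g j).headD false := fun K => by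
    induction K with
    | zero => rfl
    | succ K ih =>
      obtain ⟨b, hb⟩ := hg K
      rw [ccat_succ, ih, List.range_succ, List.map_append, List.map_singleton, hb]; rfl
  rw [key, List.getD_eq_getElem?_getD, List.getElem?_map, List.getElem?_range hr]
  rfl

/-- A concatenation of pieces `1` below `m₀` and `ε` from `m₀` on is `1^{min K m₀}`. [folklore] -/
theorem ccat_eq_ones {g : ℕ → List Bool} {m₀ : ℕ} (h1 : ∀ j, j < m₀ → g j = [true])
    (h2 : ∀ j, m₀ ≤ j → g j = []) : ∀ K, ccat g K = ones (min K m₀)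
  | 0 => by simp
  | K + 1 => by
    rw [ccat_succ, ccat_eq_ones h1 h2 K]
    by_cases hK : K < m₀
    · rw [h1 K hK, Nat.min_eq_left hK.le, Nat.min_eq_left hK, ones, ones, List.replicate_succ']
    · rw [h2 K (not_lt.1 hK), List.append_nil, Nat.min_eq_right (not_lt.1 hK),
        Nat.min_eq_right (by omega)]

/-- `uname m = 2ᵐ - 1` is strictly increasing. [folklore] -/
theorem uname_lt_uname {m m' : ℕ} (h : m < m') : uname m < uname m' := by
  rw [show uname m = 2 ^ m - 1 from bitsToNat_ones m, show uname m' = 2 ^ m' - 1 from bitsToNat_ones m']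
  have h1 : 2 ^ m < 2 ^ m' := Nat.pow_lt_pow_right (by norm_num) h
  have h2 : 1 ≤ 2 ^ m := Nat.one_le_two_pow
  omega

/-- `uname` is monotone. [folklore] -/
theorem uname_le_uname {m m' : ℕ} (h : m ≤ m') : uname m ≤ uname m' :=
  h.eq_or_lt.elim (fun e => e ▸ le_rfl) fun h => (uname_lt_uname h).le

/-- **Value of the inner piece** on `⟨⟨⟨z, code φ⟩, 1ʳ⟩, 1ᵐ⟩`: `1` iff `rank φ (uname (m+1)) ≤ r`. [folklore] -/
theorem pieceM_apply (z : List Bool) (φ : CNF ℕ) (r m : ℕ) :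
    pieceM (boolPair (boolPair (boolPair z (encodingCNF.encode φ)) (ones r)) (ones m)) =
      if rank φ (uname (m + 1)) < r + 1 then [true] else [] := by
  have ht : levinTest (boolPair (boolPair (boolPair z (encodingCNF.encode φ)) (ones r)) (ones m)) =
      [decide (rank φ (uname (m + 1)) < r + 1)] := by
    simp only [levinTest, Function.comp_apply, fanoutFn_apply, fstF_boolPair, sndF_boolPair, ltFn_boolPair,
      lenBinF_apply, bitsToNat_encodeNat, List.length_cons, List.length_replicate]
    rw [show true :: ones m = ones (m + 1) from rfl, rankF_encode, bitsToNat_encodeNat]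
    rfl
  rw [pieceM_eq, ht]
  by_cases h : rank φ (uname (m + 1)) < r + 1 <;> simp [h]

/-- **Value of the unary count** on `q = ⟨⟨z, code φ⟩, 1ʳ⟩`: the concatenation of the inner pieces
over `m < |code φ|`. [folklore] -/
theorem cntU_apply (z : List Bool) (φ : CNF ℕ) (r : ℕ) :
    cntU (boolPair (boolPair z (encodingCNF.encode φ)) (ones r)) =
      ccat (fun j => pieceM (boolPair (boolPair (boolPair z (encodingCNF.encode φ)) (ones r)) (ones j)))
        (encodingCNF.encode φ).length := by
  set qq := boolPair (boolPair z (encodingCNF.encode φ)) (ones r) with hqq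
  have hk : (encodingCNF.encode φ).length ≤ X.eval qq.length := by
    simp only [eval_X, hqq, length_boolPair]; omega
  have hi : levinInit (sndF ∘ fstF) qq =
      boolPair qq (boolPair (encodeNat (encodingCNF.encode φ).length) (boolPair (ones 0) [])) := by
    simp [levinInit, hqq]
  rw [cntU, Function.comp_apply, Function.comp_apply, hi, foldLoop_apply _ _ hk, foldAcc_appF]
  simp

/-- **The count at the rank of an occurring variable**: for `uname m₀` occurring in `φ` with
`m₀ ≤ |code φ|`, the unary count at `r = rank φ (uname m₀)` is `1^{m₀}` (ranks are monotone, and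
strictly so at occurring variables). [folklore] -/
theorem cntU_eq (z : List Bool) (φ : CNF ℕ) {m₀ : ℕ} (hocc : uname m₀ ∈ occ φ)
    (hm : m₀ ≤ (encodingCNF.encode φ).length) :
    cntU (boolPair (boolPair z (encodingCNF.encode φ)) (ones (rank φ (uname m₀)))) = ones m₀ := by
  rw [cntU_apply, ccat_eq_ones (m₀ := m₀), Nat.min_eq_right hm]
  · intro j hj
    rw [pieceM_apply, if_pos]
    exact Nat.lt_succ_of_le (rank_mono φ (uname_le_uname (by omega)))
  · intro j hj
    rw [pieceM_apply, if_neg]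
    exact not_lt.2 (Nat.succ_le_of_lt (rank_lt_rank φ hocc (uname_lt_uname (by omega))))

/-- `2ᵃ - 1 = 2ⁱ - 1 ↔ a = i`. [folklore] -/
theorem two_pow_sub_one_inj {a i : ℕ} : 2 ^ a - 1 = 2 ^ i - 1 ↔ a = i := by
  refine ⟨fun h => Nat.pow_right_injective le_rfl ?_, fun h => by rw [h]⟩
  exact Nat.sub_one_cancel Nat.one_le_two_pow Nat.one_le_two_pow h

/-- **Value of the outer piece at the rank of a tableau variable.** On
`q = ⟨⟨⟨x, u⟩, code φₓ⟩, 1^{rank φₓ (uname m₀)}⟩` with `m₀ = b · MM + idx w` the name index of the block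
variable `(b, w)`, occurring in `φₓ`: the bit emitted is the intended value of `(b, w)` on the run of
`M` on `⟨x, u⟩`. [cite: AroraBarakCC2009, Lemma 2.11] -/
theorem pieceR_eq (x u : List Bool) (b : ℕ) (w : Val M.tm)
    (hocc : uname (b * MMv M + idxV M w) ∈ occ (cnfN M p q x))
    (hm : b * MMv M + idxV M w ≤ (reduceSAT M p q x).length) :
    pieceR M p q (boolPair (boolPair (boolPair x u) (reduceSAT M p q x))
        (ones (rank (cnfN M p q x) (uname (b * MMv M + idxV M w))))) =
      [intended (M := M) x (CookLevin.PP p x.length) (TT p q x.length) u (b, w)] := by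
  set q₀ := boolPair (boolPair (boolPair x u) (reduceSAT M p q x))
    (ones (rank (cnfN M p q x) (uname (b * MMv M + idxV M w)))) with hq₀
  have hi : idxV M w < MMv M := (Tableau.valEquiv M w).isLt
  have hMM : 0 < MMv M := by omega
  have hc : cntU q₀ = ones (b * MMv M + idxV M w) := cntU_eq _ _ hocc hm
  have hdiv : (b * MMv M + idxV M w) / MMv M = b := by
    rw [show b * MMv M + idxV M w = idxV M w + MMv M * b by ring, Nat.add_mul_div_left _ _ hMM,
      Nat.div_eq_of_lt hi, Nat.zero_add]
  have hmod : (b * MMv M + idxV M w) % MMv M = idxV M w := by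
    rw [show b * MMv M + idxV M w = idxV M w + MMv M * b by ring, Nat.add_mul_mod_self_left,
      Nat.mod_eq_of_lt hi]
  have hd1 : dm1 M q₀ = boolPair (ones b) (ones (idxV M w)) := by
    simp only [dm1, Function.comp_apply, fanoutFn_apply, hc, divModFn_boolPair, hdiv, hmod]
  have hx : fstF (fstF (fstF q₀)) = x := by rw [hq₀, fstF_boolPair, fstF_boolPair, fstF_boolPair]
  -- the block `b = t · RB + J`
  set t := b / RB M x.length (CookLevin.PP p x.length) (TT p q x.length) with ht
  set J := b % RB M x.length (CookLevin.PP p x.length) (TT p q x.length) with hJ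
  have hd2 : dm2 M p q q₀ = boolPair (ones t) (ones J) := by
    simp only [dm2, Function.comp_apply, fanoutFn_apply, hd1, hx, fstF_boolPair, polyFn_apply, rbPoly_eval,
      divModFn_boolPair, ht, hJ]
  have hq : queryF M p q q₀ = boolPair (boolPair x u) (boolPair (ones t) (boolPair (ones J) [])) := by
    simp only [queryF, fanoutFn_apply, Function.comp_apply, hd2]
    rw [hq₀, fstF_boolPair, fstF_boolPair, fstF_boolPair, sndF_boolPair]
  have hs : snapFn M (queryF M p q q₀) = valWord M (absVal (cfgAt M x u t) J) := by
    rw [hq, snapFn_apply, cfgAt_eq_cfgOf]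
    simp [Tableau.qW, Tableau.qT, Tableau.qJ, ucount, ones]
  rw [pieceR, Function.comp_apply, fanoutFn_apply, Function.comp_apply, hs, Function.comp_apply, hd1,
    sndF_boolPair, valWord, eqValFn_boolPair]
  rw [show List.replicate _ true = ones (Tableau.valEquiv M (absVal (cfgAt M x u t) J)) from rfl,
    bitsToNat_ones, bitsToNat_ones]
  simp only [intended, List.cons.injEq, and_true]
  rw [Bool.eq_iff_iff]
  simp only [decide_eq_true_eq, two_pow_sub_one_inj]
  rw [show idxV M w = ((Tableau.valEquiv M w : Fin _) : ℕ) from rfl, Fin.val_inj, Equiv.apply_eq_iff_eq, eq_comm]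

/-- **Value of the witness map**: on `⟨x, u⟩`, the concatenation of the outer pieces over the positions
of the code of `φₓ`. [folklore] -/
theorem witFn_apply (x u : List Bool) :
    witFn M p q (boolPair x u) = ccat (fun j => pieceR M p q
      (boolPair (boolPair (boolPair x u) (reduceSAT M p q x)) (ones j))) (reduceSAT M p q x).length := by
  set X1 := boolPair (boolPair x u) (reduceSAT M p q x) with hX1
  have hk : (reduceSAT M p q x).length ≤ X.eval X1.length := by
    simp only [eval_X, hX1, length_boolPair]; omega
  have hc : ctxF M p q (boolPair x u) = X1 := by simp [ctxF, hX1]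
  have hi : levinInit sndF X1 = boolPair X1 (boolPair (encodeNat (reduceSAT M p q x).length) (boolPair (ones 0) [])) := by
    simp [levinInit, hX1]
  rw [witFn, Function.comp_apply, Function.comp_apply, Function.comp_apply, hc, hi, foldLoop_apply _ _ hk,
    foldAcc_appF]
  simp

/-- **The witness bit at the rank of a tableau variable is its intended value.**
[cite: AroraBarakCC2009, Lemma 2.11 and §2.3.6] -/
theorem witFn_getD (x u : List Bool) (b : ℕ) (w : Val M.tm)
    (hocc : uname (b * MMv M + idxV M w) ∈ occ (cnfN M p q x))
    (hm : b * MMv M + idxV M w ≤ (reduceSAT M p q x).length)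
    (hr : rank (cnfN M p q x) (uname (b * MMv M + idxV M w)) < (reduceSAT M p q x).length) :
    (witFn M p q (boolPair x u)).getD (rank (cnfN M p q x) (uname (b * MMv M + idxV M w))) false =
      intended (M := M) x (CookLevin.PP p x.length) (TT p q x.length) u (b, w) := by
  rw [witFn_apply, ccat_getD (fun j => oneBit_pieceR M p q _) hr, pieceR_eq M p q x u b w hocc hm]
  rfl

/-! ### Sizes: occurring names are short, ranks are below the code length -/

/-- A literal of a clause of `φ` has a variable numeral no longer than the code of `φ`. [folklore] -/
theorem length_encodeNat_le_length_encode {φ : CNF ℕ} {c : Clause ℕ} (hc : c ∈ φ) {l : Literal ℕ}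
    (hl : l ∈ c) : (encodeNat l.1).length ≤ (encodingCNF.encode φ).length := by
  obtain ⟨s, t, rfl⟩ := List.append_of_mem hc
  obtain ⟨s', t', rfl⟩ := List.append_of_mem hl
  have h1 : (clauseBlock (s' ++ l :: t')).length ≤ (encodingCNF.encode (s ++ (s' ++ l :: t') :: t)).length := by
    rw [encode_eq_header_append]
    simp [List.flatMap_append]
    omega
  have h2 : 2 * (encodingLiteral.encode l).length ≤ (clauseBlock (s' ++ l :: t')).length := by
    have e : clauseBlock (s' ++ l :: t') = SProg.dbl (boolPair (unaryEncodeNat (s' ++ l :: t').length)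
        ((s' ++ l :: t').foldr (fun a acc => boolPair (encodingLiteral.encode a) acc) [])) ++ [false, true] := rfl
    rw [e, foldr_boolPair_eq_flatMap]
    simp [List.flatMap_append]
    omega
  rw [encodingLiteral_encode] at h2
  simp at h2
  omega

/-- **The witness list satisfies the compressed Cook–Levin CNF**: if the run of `M` on `⟨x, u⟩`,
`|u| ≤ p |x|`, accepts within the time bound, the assignment read off `witFn ⟨x, u⟩` positionwise
satisfies `compress (cnfN M p q x)` — it agrees with `Tableau.intended` on the tableau variables
(`witFn_getD`), which satisfy every clause (`Tableau.complete`). [cite: AroraBarakCC2009, Lemma 2.11] -/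
theorem eval_compress_witFn (x u : List Bool) {f : List Bool → Bool} (hu : u.length ≤ CookLevin.PP p x.length)
    (hrun : M.OutputsWithin (boolPair x u) [f (boolPair x u)] (TT p q x.length)) (hf : f (boolPair x u) = true) :
    (compress (cnfN M p q x)).eval (fun i => (witFn M p q (boolPair x u)).getD i false) = true := by
  classical
  have hsat : (tableauCNF M (CookLevin.PP p x.length) (TT p q x.length) x).eval
      (intended (M := M) x (CookLevin.PP p x.length) (TT p q x.length) u) = true :=
    (HClause.eval_cnfOf _ _).2 (complete hu hrun hf)
  rw [eval_compress]
  refine Eq.trans ?_ hsat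
  refine (CNF.eval_rename (renM M) _ _).trans (CNF.eval_congr fun v hv => ?_)
  -- `v = (b, w)` occurs: its name is an occurrence of `φₓ`, short, of rank below the code length
  obtain ⟨b, w⟩ := v
  have hv' : (b, w) ∈ (tableauCNF M (CookLevin.PP p x.length) (TT p q x.length) x).flatten.map Prod.fst := by
    unfold CNF.vars at hv; rwa [List.mem_toFinset] at hv
  obtain ⟨l, hl, hl1⟩ := List.mem_map.1 hv'
  obtain ⟨c, hc, hlc⟩ := List.mem_flatten.1 hl
  have hc' : c.map (renLit (renM M)) ∈ cnfN M p q x := List.mem_map.2 ⟨c, hc, rfl⟩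
  have hl' : renLit (renM M) l ∈ c.map (renLit (renM M)) := List.mem_map.2 ⟨l, hlc, rfl⟩
  have hname : (renLit (renM M) l).1 = uname (b * MMv M + idxV M w) := by
    rw [renLit, renM, Sch.ren, hl1]
  have hocc : uname (b * MMv M + idxV M w) ∈ occ (cnfN M p q x) :=
    List.mem_map.2 ⟨_, List.mem_flatten.2 ⟨_, hc', hl'⟩, hname⟩
  have hm : b * MMv M + idxV M w ≤ (reduceSAT M p q x).length := by
    have h := length_encodeNat_le_length_encode hc' hl'
    rw [hname, encodeNat_uname, List.length_replicate] at h
    exact h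
  have hr : rank (cnfN M p q x) (uname (b * MMv M + idxV M w)) < (reduceSAT M p q x).length :=
    (rank_lt_size _ hocc).trans_le (KSatSNP.size_le_length_encode _)
  exact witFn_getD M p q x u b w hocc hm hr

end Levin

open Levin

/-- **LEVIN WITNESS MAP** (`stub_levin`; the first wall of the bridge of line `SketchIdeator5`).
Cook–Levin WITH THE LEVIN HALF: for a polynomial-time relation `R` (pairs `boolPair x u`) and
certificate bound `p`, there are a CNF family `Φ x`, its code generator `gen ∈ FP` and a WITNESS MAP
`wit ∈ FP` such that `Φ x` is satisfiable iff some `u`, `|u| ≤ p |x|`, has `boolPair x u ∈ R`, and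
from any such `u` the map `wit` computes (the bit list of) a satisfying assignment of `Φ x`.
`Φ x = compress (cnfN M p q x)` (the tree's Cook–Levin CNF with rank-compressed variables),
`gen = coreF ∘ reduceSAT M p q`, `wit = Levin.witFn M p q`.
[cite: AroraBarakCC2009, Lemma 2.11 and §2.3.6 "Levin reductions"] -/
theorem stub_levin (R : Language Bool) (hR : R ∈ Classes.P) (p : Polynomial ℕ) :
    ∃ (Φ : List Bool → CNF ℕ) (gen wit : List Bool → List Bool), gen ∈ FP ∧ wit ∈ FP ∧
      (∀ x, gen x = encodingCNF.encode (Φ x)) ∧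
      (∀ x, (Φ x).Satisfiable ↔ ∃ u : List Bool, u.length ≤ p.eval x.length ∧ boolPair x u ∈ R) ∧
      (∀ x u, u.length ≤ p.eval x.length → boolPair x u ∈ R →
        (Φ x).eval (fun i => (wit (boolPair x u)).getD i false) = true) := by
  obtain ⟨q, M, hM⟩ := mem_P_iff_holds.1 hR
  have hM' : ∀ a : List Bool, M.OutputsWithin a [(R : Set (List Bool)).boolIndicator a] (q.eval a.length) :=
    fun a => hM a
  have hrun : ∀ (x u : List Bool), u.length ≤ CookLevin.PP p x.length →
      M.OutputsWithin (boolPair x u) [(R : Set (List Bool)).boolIndicator (boolPair x u)] (TT p q x.length) :=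
    fun x u hu => (hM' (boolPair x u)).mono (TM2Iter.eval_mono q (by
      simp only [length_boolPair, NN, CookLevin.PP] at hu ⊢; omega))
  refine ⟨fun x => compress (cnfN M p q x), coreF ∘ reduceSAT M p q, witFn M p q,
    comp_mem_FP coreF_mem_FP (reduceSAT_mem_FP M p q), witFn_mem_FP M p q,
    fun x => coreF_encode _, fun x => ?_, fun x u hu hxu =>
      eval_compress_witFn M p q x u hu (hrun x u hu) ((Set.mem_iff_boolIndicator _ _).1 hxu)⟩
  rw [satisfiable_compress_iff, ← mem_SAT_iff]
  refine (reduceSAT_mem_SAT_iff M p q hM' x).trans (exists_congr fun u => and_congr Iff.rfl ?_)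
  exact (Set.mem_iff_boolIndicator (R : Set (List Bool)) (boolPair x u)).symm

end Summit.PneNP.PneNP.Theorems.LatticeMagicTarget

end
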